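import Summits.ResolutionOfSingularities.ResolutionOfSingularities.Theorems.EquisingularLiftEquisingularLiftNatPlanarSmoothingStalk
import Summits.ResolutionOfSingularities.ResolutionOfSingularities.Theorems.EquisingularLiftEquisingularLiftNatPlanarSmoothingAlgebra
import Summits.ResolutionOfSingularities.ResolutionOfSingularities.Theorems.EquisingularLiftEquisingularLiftNatEquinodalNoseModel
import Literature.AlgebraicGeometry.Resolution.AlterationsSectionDivisor
import HarnessLib

/-!
# [OURS · L1 W4.5(b) · EL♮(3) · NU7 §A2 «Σ1 SMOOTHING LEMMA», part 2c] THE SMOOTHING FAMILY AT A POINT OF THE SPECIAL FIBRE: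
# of two parameters `c₁, c₂` with `c₁ - c₂` a unit, at most one gives a non-regular model at the point

res-L1-w45b-stub-2 g19 (STUB WORKER 2), desk RULING R70 (iii).  OURS; NOT a statement of any manuscript ([Hironaka2017] is a candidate under
adjudication — nothing of it is asserted here); AI-written, weaker than expert review.  No `sorry`; standard axioms; DEF-FREE.
`--supports stmt-ResolutionOfSingularities-20148 --as helper`, counted 0.  EL♮(3) is NOT proved; resolution in positive characteristic is NOT proved.

WHAT.  `ℙⁿ_O = Proj O[x₀..xₙ]` over any commutative ring `O` with an element `ϖ`; a point `x ∈ D₊(x_d)` of the special fibre (`ϖ ∈ 𝔭_x`); a linear form `L̃` and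
forms `A, M` of degree `e` with `L̃, A ∈ 𝔭_x` and `M ∉ 𝔭_x`; the letter `𝓛 = (L̃)~` regular at the point over `x`, and the constant germ `Θ_x ϖ` off
`𝓛_x + 𝔪_x²` («`ϖ` is a regular parameter of the host at `x`»).  For the family `𝓦_c = (L̃, A + c·ϖ·M)~`:
★ `isRegularLocalRing_quotient_stalkIdeal_or` — if `c₁ - c₂` is a unit of `O`, then `𝒪_{ℙⁿ,x} ⧸ (𝓦_{c₁})_x` or `𝒪_{ℙⁿ,x} ⧸ (𝓦_{c₂})_x` is a regular
local ring.  Proof: `(𝓦_c)_x = 𝓛_x + (Θ_x F_c)` (✓ `CILift.stalkIdeal_projIdealSheaf_span`), `Θ_x F_c = Θ_x A + Θ_x c · Θ_x ϖ · Θ_x M` (part 2b), the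
one-bad-residue dichotomy with `J = 𝓛_x + 𝔪_x²` (part 2a `one_bad_residue`), and the hypersurface criterion through the stalk map of `V(𝓛) ↪ ℙⁿ`
(part 2a `isRegularLocalRing_quotient_ker_sup_span`, Matsumura 14.2).
References (method / index only): H. Matsumura, *Commutative Ring Theory* (1986), Thm. 14.2; R. Hartshorne, *Algebraic Geometry* (1977), II Prop. 5.9.
-/

set_option linter.dupNamespace false -- mandated namespace `Summit.<Summit>.<Problem>` of this single-conjunct summit

noncomputable section

open CategoryTheory AlgebraicGeometry TopologicalSpace IsLocalRing
open MvPolynomial HomogeneousLocalization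
open Literature.AlgebraicGeometry.Resolution
open AlgebraicGeometry.Scheme.IdealSheafData

namespace Summit.ResolutionOfSingularities.ResolutionOfSingularities.Cruxes.EquisingularLiftNat.Sections.PlanarSmoothing

open Summit.ResolutionOfSingularities.ResolutionOfSingularities.Cruxes.EquisingularLiftNat.Sections
open Summit.ResolutionOfSingularities.ResolutionOfSingularities.Cruxes.EquisingularLiftNat.Sections.Equinodal

variable {O : Type} [CommRing O] {ϖ : O} {n e : ℕ}

/-- The second generator of the smoothing family is homogeneous of degree `e`. [folklore] -/
theorem add_C_mul_mem (A M : MvPolynomial (Fin (n + 1)) O) (hA : A ∈ homogeneousSubmodule (Fin (n + 1)) O e)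
    (hM : M ∈ homogeneousSubmodule (Fin (n + 1)) O e) (r : O) :
    A + C r * M ∈ homogeneousSubmodule (Fin (n + 1)) O e :=
  add_mem hA ((mem_homogeneousSubmodule e _).mpr (((mem_homogeneousSubmodule e M).mp hM).C_mul r))

/-- Degree certificate of the family `![L̃, A + c·M]`. [folklore] -/
theorem pair_mem (Lt A M : MvPolynomial (Fin (n + 1)) O) (hLt : Lt ∈ homogeneousSubmodule (Fin (n + 1)) O 1)
    (hA : A ∈ homogeneousSubmodule (Fin (n + 1)) O e) (hM : M ∈ homogeneousSubmodule (Fin (n + 1)) O e) (r : O) :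
    ∀ l, (![Lt, A + C r * M] : Fin 2 → MvPolynomial (Fin (n + 1)) O) l ∈ homogeneousSubmodule (Fin (n + 1)) O ((![1, e] : Fin 2 → ℕ) l) := by
  intro l; fin_cases l
  · exact hLt
  · exact add_C_mul_mem A M hA hM r

/-- Degree certificate of the letter `![L̃]`. [folklore] -/
theorem single_mem (Lt : MvPolynomial (Fin (n + 1)) O) (hLt : Lt ∈ homogeneousSubmodule (Fin (n + 1)) O 1) :
    ∀ l, (![Lt] : Fin 1 → MvPolynomial (Fin (n + 1)) O) l ∈ homogeneousSubmodule (Fin (n + 1)) O ((![1] : Fin 1 → ℕ) l) := by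
  intro l; fin_cases l; exact hLt

set_option maxHeartbeats 800000 in -- two stalk-ideal computations and the dichotomy in one statement
/-- ★ **THE SMOOTHING FAMILY AT A POINT OF THE SPECIAL FIBRE: of `c₁, c₂` with `c₁ - c₂` a unit, at most one is bad.**  See the module docstring.
[cite: Matsumura1987, Thm. 14.2] [OURS · NU7 §A2 part 2c] -/
theorem isRegularLocalRing_quotient_stalkIdeal_or (d : Fin (n + 1)) :
    letI := MvPolynomial.gradedAlgebra (σ := Fin (n + 1)) (R := O)
    ∀ (x : Proj (homogeneousSubmodule (Fin (n + 1)) O))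
    (hx : x ∈ Proj.basicOpen (homogeneousSubmodule (Fin (n + 1)) O) (X d)), (C ϖ : MvPolynomial (Fin (n + 1)) O) ∈ x.asHomogeneousIdeal →
    ∀ (Lt A M : MvPolynomial (Fin (n + 1)) O) (hLt : Lt ∈ homogeneousSubmodule (Fin (n + 1)) O 1)
    (hA : A ∈ homogeneousSubmodule (Fin (n + 1)) O e) (hM : M ∈ homogeneousSubmodule (Fin (n + 1)) O e),
    Lt ∈ x.asHomogeneousIdeal → A ∈ x.asHomogeneousIdeal → M ∉ x.asHomogeneousIdeal →
    (∀ x' : ↥(projIdealSheaf (homogeneousSubmodule (Fin (n + 1)) O) ⟨Ideal.span (Set.range ![Lt]), isHomogeneous_span_of_forall_mem _ _ _ (single_mem Lt hLt)⟩).subscheme,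
      (projIdealSheaf (homogeneousSubmodule (Fin (n + 1)) O) ⟨Ideal.span (Set.range ![Lt]), isHomogeneous_span_of_forall_mem _ _ _ (single_mem Lt hLt)⟩).subschemeι x' = x →
      IsRegularLocalRing ((projIdealSheaf (homogeneousSubmodule (Fin (n + 1)) O) ⟨Ideal.span (Set.range ![Lt]),
        isHomogeneous_span_of_forall_mem _ _ _ (single_mem Lt hLt)⟩).subscheme.presheaf.stalk x')) →
    ((Proj (homogeneousSubmodule (Fin (n + 1)) O)).presheaf.germ (Proj.basicOpen (homogeneousSubmodule (Fin (n + 1)) O) (X d)) x hx).hom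
        ((Proj.awayToSection (homogeneousSubmodule (Fin (n + 1)) O) (X d)).hom
          (mk₁ (homogeneousSubmodule (Fin (n + 1)) O) (CILift.X_mem_one' d) 0 (C ϖ) (isHomogeneous_C _ ϖ))) ∉
      stalkIdeal (projIdealSheaf (homogeneousSubmodule (Fin (n + 1)) O) ⟨Ideal.span (Set.range ![Lt]), isHomogeneous_span_of_forall_mem _ _ _ (single_mem Lt hLt)⟩) x ⊔
        maximalIdeal ((Proj (homogeneousSubmodule (Fin (n + 1)) O)).presheaf.stalk x) ^ 2 →
    ∀ (c₁ c₂ : O), IsUnit (c₁ - c₂) →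
    IsRegularLocalRing ((Proj (homogeneousSubmodule (Fin (n + 1)) O)).presheaf.stalk x ⧸
        stalkIdeal (projIdealSheaf (homogeneousSubmodule (Fin (n + 1)) O) ⟨Ideal.span (Set.range ![Lt, A + C (c₁ * ϖ) * M]),
          isHomogeneous_span_of_forall_mem _ _ _ (pair_mem Lt A M hLt hA hM (c₁ * ϖ))⟩) x) ∨
    IsRegularLocalRing ((Proj (homogeneousSubmodule (Fin (n + 1)) O)).presheaf.stalk x ⧸
        stalkIdeal (projIdealSheaf (homogeneousSubmodule (Fin (n + 1)) O) ⟨Ideal.span (Set.range ![Lt, A + C (c₂ * ϖ) * M]),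
          isHomogeneous_span_of_forall_mem _ _ _ (pair_mem Lt A M hLt hA hM (c₂ * ϖ))⟩) x) := by
  classical
  letI := MvPolynomial.gradedAlgebra (σ := Fin (n + 1)) (R := O)
  intro x hx hxϖ Lt A M hLt hA hM hLtx hAx hMx hLreg hϖL c₁ c₂ hc
  haveI : x.asHomogeneousIdeal.toIdeal.IsPrime := x.isPrime
  -- the point `x'` of `V(𝓛)` over `x`
  have hLm := germ_mk₁_mem_maximalIdeal_of_mem d 1 Lt hLt x hx hLtx
  have hstalkL : stalkIdeal (projIdealSheaf (homogeneousSubmodule (Fin (n + 1)) O) ⟨Ideal.span (Set.range ![Lt]),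
      isHomogeneous_span_of_forall_mem _ _ _ (single_mem Lt hLt)⟩) x = Ideal.span {((Proj (homogeneousSubmodule (Fin (n + 1)) O)).presheaf.germ
        (Proj.basicOpen (homogeneousSubmodule (Fin (n + 1)) O) (X d)) x hx).hom ((Proj.awayToSection (homogeneousSubmodule (Fin (n + 1)) O) (X d)).hom
          (mk₁ (homogeneousSubmodule (Fin (n + 1)) O) (CILift.X_mem_one' d) 1 Lt hLt))} := by
    rw [CILift.stalkIdeal_projIdealSheaf_span (![Lt]) (![1]) (single_mem Lt hLt) d x hx, Set.range_unique]
    rfl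
  have hxsupp : x ∈ (projIdealSheaf (homogeneousSubmodule (Fin (n + 1)) O) ⟨Ideal.span (Set.range ![Lt]),
      isHomogeneous_span_of_forall_mem _ _ _ (single_mem Lt hLt)⟩).support := by
    rw [mem_support_iff_stalkIdeal_le, hstalkL, Ideal.span_singleton_le_iff_mem]; exact hLm
  obtain ⟨x', hx'⟩ : x ∈ Set.range (projIdealSheaf (homogeneousSubmodule (Fin (n + 1)) O) ⟨Ideal.span (Set.range ![Lt]),
      isHomogeneous_span_of_forall_mem _ _ _ (single_mem Lt hLt)⟩).subschemeι := by
    rw [Scheme.IdealSheafData.range_subschemeι]; exact hxsupp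
  haveI hBreg := hLreg x' hx'
  -- the chart germs `γ m F`, opaque
  obtain ⟨γ, hγ⟩ : ∃ γ : ∀ (m : ℕ) (F : MvPolynomial (Fin (n + 1)) O), F ∈ homogeneousSubmodule (Fin (n + 1)) O m →
      (Proj (homogeneousSubmodule (Fin (n + 1)) O)).presheaf.stalk x, ∀ m F hF, γ m F hF =
      ((Proj (homogeneousSubmodule (Fin (n + 1)) O)).presheaf.germ (Proj.basicOpen (homogeneousSubmodule (Fin (n + 1)) O) (X d)) x hx).hom
        ((Proj.awayToSection (homogeneousSubmodule (Fin (n + 1)) O) (X d)).hom (mk₁ (homogeneousSubmodule (Fin (n + 1)) O) (CILift.X_mem_one' d) m F hF)) :=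
    ⟨_, fun _ _ _ => rfl⟩
  -- membership of the forms in `𝔭_x`, degrees
  have hCϖx : ∀ c : O, (C (c * ϖ) : MvPolynomial (Fin (n + 1)) O) * M ∈ x.asHomogeneousIdeal := by
    intro c
    have h1 : (C (c * ϖ) : MvPolynomial (Fin (n + 1)) O) ∈ x.asHomogeneousIdeal.toIdeal := by
      rw [C_mul]; exact Ideal.mul_mem_left _ _ hxϖ
    exact Ideal.mul_mem_right _ _ h1
  have hFx : ∀ c : O, A + C (c * ϖ) * M ∈ x.asHomogeneousIdeal := fun c => Ideal.add_mem _ hAx (hCϖx c)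
  have hCMmem : ∀ r : O, (C r : MvPolynomial (Fin (n + 1)) O) * M ∈ homogeneousSubmodule (Fin (n + 1)) O e := fun r =>
    (mem_homogeneousSubmodule e _).mpr (((mem_homogeneousSubmodule e M).mp hM).C_mul r)
  have hCC : ∀ a b : O, (C a : MvPolynomial (Fin (n + 1)) O) * C b ∈ homogeneousSubmodule (Fin (n + 1)) O 0 := fun a b => by
    rw [← C_mul]; exact isHomogeneous_C _ _
  -- `π := (V(𝓛) ↪ ℙⁿ)♯_{x'}`, read at `x`: surjective, local, kernel `𝓛_x = (γ L̃)`
  subst hx'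
  let π := ((projIdealSheaf (homogeneousSubmodule (Fin (n + 1)) O) ⟨Ideal.span (Set.range ![Lt]),
      isHomogeneous_span_of_forall_mem _ _ _ (single_mem Lt hLt)⟩).subschemeι.stalkMap x').hom
  have hπsurj : Function.Surjective π := Scheme.Hom.stalkMap_surjective _ x'
  haveI : IsLocalHom π := inferInstanceAs (IsLocalHom (Scheme.Hom.stalkMap _ x').hom)
  have hker : RingHom.ker π = Ideal.span {γ 1 Lt hLt} := by
    rw [hγ, ← hstalkL]
    change RingHom.ker (Scheme.Hom.stalkMap _ x').hom = _
    rw [← stalkIdeal_ker_eq_ker_stalkMap _ x', ker_subschemeι]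
  -- the dichotomy ideal `J = ker π ⊔ 𝔪_x²` does not contain the constant germ `ϖ`
  have hϖJ : γ 0 (C ϖ) (isHomogeneous_C _ ϖ) ∉ RingHom.ker π ⊔ maximalIdeal _ ^ 2 := by
    rw [hker]; simp only [hγ]; rw [← hstalkL]; exact hϖL
  -- units: `γ M` and `γ (c₁ - c₂)`
  have hMu : IsUnit (γ e M hM) := by rw [hγ]; exact isUnit_germ_mk₁_of_notMem d e M hM _ hx hMx
  have hcu : IsUnit (γ 0 (C (c₁ - c₂)) (isHomogeneous_C _ _)) := by
    rw [hγ]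
    refine isUnit_germ_mk₁_of_notMem d 0 (C (c₁ - c₂)) (isHomogeneous_C _ _) _ hx fun hmem => ?_
    exact (ProjectiveSpectrum.isPrime _).ne_top (Ideal.eq_top_of_isUnit_mem _ hmem (hc.map C))
  -- constants: `γ (a b) = γ a · γ b`, `γ c₁ - γ c₂ = γ (c₁ - c₂)`
  have hγC : ∀ a b : O, γ 0 (C (a * b)) (isHomogeneous_C _ _) = γ 0 (C a) (isHomogeneous_C _ _) * γ 0 (C b) (isHomogeneous_C _ _) := by
    intro a b
    rw [hγ, hγ, hγ, ← germ_mk₁_C_mul d 0 a (C b) (isHomogeneous_C _ _) (hCC a b) _ hx]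
    exact congrArg _ (congrArg _ (mk₁_congr _ _ (C_mul (a := a) (a' := b)) _ _))
  have hγsub : γ 0 (C c₁) (isHomogeneous_C _ _) - γ 0 (C c₂) (isHomogeneous_C _ _) = γ 0 (C (c₁ - c₂)) (isHomogeneous_C _ _) := by
    rw [sub_eq_iff_eq_add, hγ, hγ, hγ, ← germ_mk₁_add d 0 (C (c₁ - c₂)) (C c₂) (isHomogeneous_C _ _) (isHomogeneous_C _ _) _ hx]
    exact congrArg _ (congrArg _ (mk₁_congr _ _ (by rw [← C_add, sub_add_cancel]) _ _))
  have hc' : IsUnit (γ 0 (C c₁) (isHomogeneous_C _ _) - γ 0 (C c₂) (isHomogeneous_C _ _)) := by rw [hγsub]; exact hcu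
  -- `γ F_c = γ A + γ c · γ ϖ · γ M`
  have hFc : ∀ c : O, γ e (A + C (c * ϖ) * M) (add_C_mul_mem A M hA hM (c * ϖ)) =
      γ e A hA + γ 0 (C c) (isHomogeneous_C _ _) * γ 0 (C ϖ) (isHomogeneous_C _ _) * γ e M hM := by
    intro c
    rw [← hγC, hγ, hγ, hγ, hγ, germ_mk₁_add d e A (C (c * ϖ) * M) hA (hCMmem (c * ϖ)) _ hx,
      germ_mk₁_C_mul d e (c * ϖ) M hM (hCMmem (c * ϖ)) _ hx]
  -- the stalk ideals of the family: `(𝓦_c)_x = ker π ⊔ (γ F_c)`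
  have hstalkW : ∀ c : O, stalkIdeal (projIdealSheaf (homogeneousSubmodule (Fin (n + 1)) O) ⟨Ideal.span (Set.range ![Lt, A + C (c * ϖ) * M]),
          isHomogeneous_span_of_forall_mem _ _ _ (pair_mem Lt A M hLt hA hM (c * ϖ))⟩) ((projIdealSheaf (homogeneousSubmodule (Fin (n + 1)) O) ⟨Ideal.span (Set.range ![Lt]),
      isHomogeneous_span_of_forall_mem _ _ _ (single_mem Lt hLt)⟩).subschemeι x') =
      RingHom.ker π ⊔ Ideal.span {γ e (A + C (c * ϖ) * M) (add_C_mul_mem A M hA hM (c * ϖ))} := by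
    intro c
    rw [CILift.stalkIdeal_projIdealSheaf_span (![Lt, A + C (c * ϖ) * M]) (![1, e]) (pair_mem Lt A M hLt hA hM (c * ϖ)) d _ hx, hker,
      ← Ideal.span_insert, ← NoseModel.span_range_pair, hγ, hγ]
    exact congrArg Ideal.span (congrArg Set.range (funext fun l => by fin_cases l <;> rfl))
  -- `γ F_c ∈ 𝔪_x`
  have hFm : ∀ c : O, γ e (A + C (c * ϖ) * M) (add_C_mul_mem A M hA hM (c * ϖ)) ∈ maximalIdeal _ := fun c => by
    rw [hγ]; exact germ_mk₁_mem_maximalIdeal_of_mem d e _ _ _ hx (hFx c)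
  -- regularity off `J`, then the dichotomy
  have key : ∀ c : O, γ e (A + C (c * ϖ) * M) (add_C_mul_mem A M hA hM (c * ϖ)) ∉ RingHom.ker π ⊔ maximalIdeal _ ^ 2 →
      IsRegularLocalRing ((Proj (homogeneousSubmodule (Fin (n + 1)) O)).presheaf.stalk ((projIdealSheaf (homogeneousSubmodule (Fin (n + 1)) O) ⟨Ideal.span (Set.range ![Lt]),
      isHomogeneous_span_of_forall_mem _ _ _ (single_mem Lt hLt)⟩).subschemeι x') ⧸
        stalkIdeal (projIdealSheaf (homogeneousSubmodule (Fin (n + 1)) O) ⟨Ideal.span (Set.range ![Lt, A + C (c * ϖ) * M]),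
          isHomogeneous_span_of_forall_mem _ _ _ (pair_mem Lt A M hLt hA hM (c * ϖ))⟩) ((projIdealSheaf (homogeneousSubmodule (Fin (n + 1)) O) ⟨Ideal.span (Set.range ![Lt]),
      isHomogeneous_span_of_forall_mem _ _ _ (single_mem Lt hLt)⟩).subschemeι x')) := by
    intro c hnot
    have h := isRegularLocalRing_quotient_ker_sup_span π hπsurj (hFm c) hnot
    rw [← hstalkW c] at h
    exact h
  by_contra hboth
  rw [not_or] at hboth
  have h₁ : γ e (A + C (c₁ * ϖ) * M) (add_C_mul_mem A M hA hM (c₁ * ϖ)) ∈ RingHom.ker π ⊔ maximalIdeal _ ^ 2 := by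
    by_contra h; exact hboth.1 (key c₁ h)
  have h₂ : γ e (A + C (c₂ * ϖ) * M) (add_C_mul_mem A M hA hM (c₂ * ϖ)) ∈ RingHom.ker π ⊔ maximalIdeal _ ^ 2 := by
    by_contra h; exact hboth.2 (key c₂ h)
  rw [hFc] at h₁ h₂
  exact one_bad_residue _ hϖJ hMu hc' h₁ h₂

end Summit.ResolutionOfSingularities.ResolutionOfSingularities.Cruxes.EquisingularLiftNat.Sections.PlanarSmoothing

end
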